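import Summits.ABC.ABC.Theorems.IUTThetaPilotThetaPartIIOfChildren
import Summits.ABC.ABC.Theorems.IUTThetaPilotThetaPartIIDegLe
import Summits.ABC.IUTFork.Cor312ProvenanceGenuine
import Summits.ABC.IUTFork.Cor312PinnedRegionsThreePins
import HarnessLib

/-!
# Route `IUTThetaPilot`, crux `ThetaPartII` (stmt-ABC-19678): `abc` (and its `d = 1` cut) from the residual
# `S := PilotKummerIndRelated` AT THE Θ-DATA OF THE `λ`-LINE — the branch-C apex RE-BASED on the campaign-S chain

S. Mochizuki, *Inter-universal Teichmüller theory III*, kurims manuscript (May 2020), Cor. 3.12 statement p. 173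
l. 41 – p. 174 l. 19, proof Steps (xi-e)/(xi-f) p. 183 l. 43 – p. 184 l. 29; *IV* (Apr. 2020) Thm. 1.10 pp. 22–31,
Cor. 2.2 (ii) pp. 41–48, Cor. 2.3 pp. 49–55; [GenEll] Thm. 2.1 pp. 11–13.

WHAT THIS FILE DOES (proof-only, composition BY NAME; nothing new is defined or asserted). Branch C («abc ⇐ S»,
HOME/plan/C/ABC-OF-S-SPEC.md) filed its v0 apex over the kernel-DAG apex `DAG.summit_of_cor312`, whose data binder
`A : AbcDictionary V` is a hypothesis structure of abc strength (ForkAbc docstring) and whose `hInd` is the whole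
multiradial estimate; HOME/plan/conditional/HYPS.tsv names as «v1+ candidate: re-base the apex on the S-chain so A
disappears». This file IS that re-basing. Per admissible `λ`-line point `P ∈ U_P`, prime `l ≥ 5` with `AdmitsCore`,
(P2), (P5), (P6), and per genuine Θ-volume datum `T : Cor22.ThetaVolumeDatumAt P l` (abc-iut-S2 / w4-d037; child (i) of
the crux is a THEOREM: `ThetaPartII.stub_thetaData`), take ANY typed lattice situation `St T` of [IUTchIII] Thm. 3.11,
ANY Cor.-3.12 setting `Pc T` over it ATTACHED TO THE DATUM'S INITIAL Θ-DATA (`Cor312Prov.IsSettingOf T.D (Pc T)`,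
abc-iut-c312-8: index data + the printed `q`-side identification [IUTchIV] p. 23), a region reading `ρ T` and a q-pilot
Kummer datum `qK T` (PR-1). Then:

* `cor312Of_datum_of_pilotKummerIndRelated` — at ONE datum: provenance + BridgeHyps + Thm. 3.11 (ii)(b) for column `n`
  + the three pins + **S** ⟹ the verbatim `Setting.Statement` (abc-iut-w5-d230's
  `statement_of_pinned3_of_pilotKummerIndRelated`) ⟹ under the ONE Θ-side reading `hΘ : (Pc T).negLogTheta ≤ ↑T.negLogTheta`
  (verbatim `−|log(Θ)|` at most the datum's DEFINED number, `GenuineLogTheta`) the datum's `T.Cor312Of`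
  (abc-iut-c312-8's `Cor312Prov.cor312Of_of_statement_of_links`; the `q`-sides agree by provenance, no hypothesis).
* `cor312AtDatum_of_pilotKummerIndRelated` — hence `Cor22.Cor312AtDatum P l` (= the crux's child (iii) `stub_cor312` at
  `(P, l)`).
* (appended in the sequel revision, once the olean of `IUTThetaPilotThetaPartIIDegLe` is available on the farm)
  `vojta_degOne_of_pilotKummerIndRelated` — the «d = 1 cut» with NO further input: S (+ setting data, pins, bridge
  hypotheses, (ii)(b), `hΘ`) at the Θ-data of the RATIONAL points of the `λ`-line ⟹ Vojta's height inequality for the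
  degree-1 points of every compactly bounded `K_V ∋ 2` (abc-iut-S2's `ThetaPartIIDisplay.vojtaIneq_two_degOne_of_cor312`,
  whose log-volume side is DISCHARGED at `d_mod = 1`).
* **`thetaPartII_of_pilotKummerIndRelated`** / **`abc_of_pilotKummerIndRelated_of_genEllTwo`** — the crux, resp. `_root_.ABC`,
  from S at all admissible `(P, l, T)` + the computable half (ii′) in its registered form (`stub_hullVolume`; a theorem at
  `d_mod = 1` and on slot-constant data, HOME/plan/D9PRIME-OBLIGATIONS.md §1c) + the support item `GenEllTwo` ([GenEll]
  Thm. 2.1 at `Σ = {2}`, stmt-ABC-19679) — through abc-iut-S2's `ABC_of_cor312_of_hullVolume_of_genEllTwo`. No `AbcDictionary`,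
  no `HeightFamily`, no `MochizukiIndeterminacies`; the `q`-side identification is PROVED (inside `IsSettingOf`).

C-SCOREBOARD SHAPE of `abc_of_pilotKummerIndRelated_of_genEllTwo` (Prop binders, each ∀-guarded by the admissibility
binders of `Cor22.Thm110Legendre`): [S] `hS` ×1 · [PIN] `hPin` (three pins), `hBridge` (bridge hypotheses), `hSet`
(provenance `IsSettingOf`, incl. the printed `q`-side identification) ×3 · [CONE] `hKumB` (Thm. 3.11 (ii)(b) `KummerB` at
column `n` ONLY — strictly weaker than `FullSituation.Statement`), `hvol` (computable half (ii′), S-lane) ×2 · [READ] `hΘ` ×1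
· [SUPPORT] `hG` (`GenEllTwo`) ×1 = 8; the `d = 1` cut drops `hvol` and `hG` (= 6). CONDITIONAL results (`--supports
stmt-ABC-19678`): the crux item stays OPEN. HONEST FRAMING: nothing here asserts abc, [IUTchIV] Thm. 1.10, [IUTchIII]
Cor. 3.12 or S, or takes a side on any author (Mochizuki / Scholze–Stix / Joshi / Dupuy–Hilado); S is an assumption
label; typed ≠ proved; instantiated ≠ endorsed. [claim: Mochizuki2012, status: disputed] for every IUT sentence quoted.
-/

set_option linter.dupNamespace false

noncomputable section

namespace Summit.ABC.ABC.Theorems.ThetaPartII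

open Literature.NumberTheory.DiophantineGeometry Literature.NumberTheory.DiophantineGeometry.GenEll
open Literature.IUT.LogVolume Summit.ABC.IUTFork Summit.ABC.IUTFork.Thm311 Summit.ABC.IUTFork.Cor312Vol

/-! ## 1. At one datum -/

/-- **S at one genuine Θ-volume datum gives [IUTchIII] Cor. 3.12 for that datum's DEFINED numbers.** For a datum
`T` at `(P, l)`, a lattice situation `St`, a Cor.-3.12 setting `Pc` over it attached to `T.D` (`hSet`), a region reading
`ρ` and q-datum `qK`: bridge hypotheses (`hBridge`), Thm. 3.11 (ii) (b) for column `n` (`hKumB`), the three pins (`hPin`),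
the residual S (`hS`, [IUTchIII] (xi-e)/(xi-f) p. 183 l. 43 – p. 184 l. 29) and the Θ-side reading `hΘ` (the verbatim
`−|log(Θ)| ∈ ℝ ∪ {+∞}` is at most the datum's number) imply `T.Cor312Of` (`−|log(q)| ≤ −|log(Θ)|` for the numbers of
`GenuineLogTheta`). Composition of `statement_of_pinned3_of_pilotKummerIndRelated` (abc-iut-w5-d230) and
`Cor312Prov.cor312Of_of_statement_of_links` (abc-iut-c312-8). CONDITIONAL; asserts nothing.
[cite: Mochizuki2012, IUTchIII Cor. 3.12 p.173–174] [claim: Mochizuki2012, status: disputed] -/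
theorem cor312Of_datum_of_pilotKummerIndRelated {P : NFPoint} {l : ℕ} (T : Cor22.ThetaVolumeDatumAt P l)
    {TI : ThetaIndex} (St : LatticeSituation TI) (Pc : Cor312.Setting St.toSituation)
    (ρ : (∀ v : TI.V, v ∈ TI.Vbad → Set (St.L.StarPacket v)) → ∀ (j : TI.Label) (vQ : TI.VQ), Set (St.L.Packet j vQ))
    (qK : ∀ v : TI.V, v ∈ TI.Vbad → Set (St.L.StarPacket v))
    (hSet : letI := T.instFieldF; letI := T.instNumberFieldF; letI := T.instAlgebraF; letI := T.instFieldK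
      letI := T.instNumberFieldK; letI := T.instAlgebraK; letI := T.instFieldFbar; letI := T.instAlgebraFbar
      letI := T.instAlgebraKFbar; letI := T.instIsElliptic
      Cor312Prov.IsSettingOf T.D Pc)
    (hBridge : BridgeHyps Pc) (hKumB : (St.col Pc.n).KummerB (St.D Pc.n))
    (hPin : PinnedRegions3 St Pc ρ qK) (hS : PilotKummerIndRelated St Pc ρ qK)
    (hΘ : Pc.negLogTheta ≤ ((T.negLogTheta : ℝ) : WithTop ℝ)) : T.Cor312Of := by
  letI := T.instFieldF; letI := T.instNumberFieldF; letI := T.instAlgebraF; letI := T.instFieldK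
  letI := T.instNumberFieldK; letI := T.instAlgebraK; letI := T.instFieldFbar; letI := T.instAlgebraFbar
  letI := T.instAlgebraKFbar; letI := T.instIsElliptic
  have hst : Pc.Statement := statement_of_pinned3_of_pilotKummerIndRelated St Pc ρ qK hBridge hKumB hPin hS
  exact Cor312Prov.cor312Of_of_statement_of_links T.D T.isVolumeInputOf hSet hΘ hst

/-- **`Cor22.Cor312AtDatum P l` from S at every datum of `(P, l)`** (the crux's child (iii) `stub_cor312` at one
`(P, l)`): if every genuine Θ-volume datum at `(P, l)` carries setting data as in
`cor312Of_datum_of_pilotKummerIndRelated` with S, the pins, the bridge hypotheses, (ii)(b) at column `n` and `hΘ`, then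
[IUTchIII] Cor. 3.12 holds at the Θ-data of `(P, l)` for the DEFINED numbers. CONDITIONAL; asserts nothing.
[cite: Mochizuki2012, IUTchIII Cor. 3.12 p.173–174] [claim: Mochizuki2012, status: disputed] -/
theorem cor312AtDatum_of_pilotKummerIndRelated {P : NFPoint} {l : ℕ}
    (TI : Cor22.ThetaVolumeDatumAt P l → ThetaIndex)
    (St : ∀ T : Cor22.ThetaVolumeDatumAt P l, LatticeSituation (TI T))
    (Pc : ∀ T : Cor22.ThetaVolumeDatumAt P l, Cor312.Setting (St T).toSituation)
    (ρ : ∀ T : Cor22.ThetaVolumeDatumAt P l,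
      (∀ v : (TI T).V, v ∈ (TI T).Vbad → Set ((St T).L.StarPacket v)) →
        ∀ (j : (TI T).Label) (vQ : (TI T).VQ), Set ((St T).L.Packet j vQ))
    (qK : ∀ T : Cor22.ThetaVolumeDatumAt P l, ∀ v : (TI T).V, v ∈ (TI T).Vbad → Set ((St T).L.StarPacket v))
    (hSet : ∀ T : Cor22.ThetaVolumeDatumAt P l,
      letI := T.instFieldF; letI := T.instNumberFieldF; letI := T.instAlgebraF; letI := T.instFieldK
      letI := T.instNumberFieldK; letI := T.instAlgebraK; letI := T.instFieldFbar; letI := T.instAlgebraFbar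
      letI := T.instAlgebraKFbar; letI := T.instIsElliptic
      Cor312Prov.IsSettingOf T.D (Pc T))
    (hBridge : ∀ T, BridgeHyps (Pc T)) (hKumB : ∀ T, ((St T).col (Pc T).n).KummerB ((St T).D (Pc T).n))
    (hPin : ∀ T, PinnedRegions3 (St T) (Pc T) (ρ T) (qK T))
    (hS : ∀ T, PilotKummerIndRelated (St T) (Pc T) (ρ T) (qK T))
    (hΘ : ∀ T : Cor22.ThetaVolumeDatumAt P l, (Pc T).negLogTheta ≤ ((T.negLogTheta : ℝ) : WithTop ℝ)) :
    Cor22.Cor312AtDatum P l := fun T =>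
  cor312Of_datum_of_pilotKummerIndRelated T (St T) (Pc T) (ρ T) (qK T) (hSet T) (hBridge T) (hKumB T) (hPin T)
    (hS T) (hΘ T)

/-! ## 3. The crux and `abc` from S + the computable half + `GenEllTwo` -/

/-- **The crux `ThetaPartII` from S** at the Θ-data of every admissible `(P, l)` of the `λ`-line (with setting data,
pins, bridge hypotheses, (ii)(b) at column `n`, `hΘ`) + the computable half (ii′) in its registered form (`hvol`, the
`stub_hullVolume` statement with print's `B_III(P, l)`): abc-iut-S2's `ThetaPartII_of_cor312_of_hullVolume` composed with
`cor312AtDatum_of_pilotKummerIndRelated`. CONDITIONAL; the crux item stays open.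
[cite: Mochizuki2012, IUTchIV Cor. 2.2 (ii) pp.41–48] [claim: Mochizuki2012, status: disputed] -/
theorem thetaPartII_of_pilotKummerIndRelated
    (TI : ∀ {P : NFPoint} {l : ℕ}, Cor22.ThetaVolumeDatumAt P l → ThetaIndex)
    (St : ∀ {P : NFPoint} {l : ℕ} (T : Cor22.ThetaVolumeDatumAt P l), LatticeSituation (TI T))
    (Pc : ∀ {P : NFPoint} {l : ℕ} (T : Cor22.ThetaVolumeDatumAt P l), Cor312.Setting (St T).toSituation)
    (ρ : ∀ {P : NFPoint} {l : ℕ} (T : Cor22.ThetaVolumeDatumAt P l),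
      (∀ v : (TI T).V, v ∈ (TI T).Vbad → Set ((St T).L.StarPacket v)) →
        ∀ (j : (TI T).Label) (vQ : (TI T).VQ), Set ((St T).L.Packet j vQ))
    (qK : ∀ {P : NFPoint} {l : ℕ} (T : Cor22.ThetaVolumeDatumAt P l),
      ∀ v : (TI T).V, v ∈ (TI T).Vbad → Set ((St T).L.StarPacket v))
    (hSet : ∀ P : NFPoint, P ∈ UP → ∀ l : ℕ, l.Prime → 5 ≤ l →
      Cor22.AdmitsCore P → Cor22.CondP2 P l → Cor22.CondP5 P l → Cor22.CondP6 P l →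
      ∀ T : Cor22.ThetaVolumeDatumAt P l,
        letI := T.instFieldF; letI := T.instNumberFieldF; letI := T.instAlgebraF; letI := T.instFieldK
        letI := T.instNumberFieldK; letI := T.instAlgebraK; letI := T.instFieldFbar; letI := T.instAlgebraFbar
        letI := T.instAlgebraKFbar; letI := T.instIsElliptic
        Cor312Prov.IsSettingOf T.D (Pc T))
    (hBridge : ∀ P : NFPoint, P ∈ UP → ∀ l : ℕ, l.Prime → 5 ≤ l →
      Cor22.AdmitsCore P → Cor22.CondP2 P l → Cor22.CondP5 P l → Cor22.CondP6 P l →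
      ∀ T : Cor22.ThetaVolumeDatumAt P l, BridgeHyps (Pc T))
    (hKumB : ∀ P : NFPoint, P ∈ UP → ∀ l : ℕ, l.Prime → 5 ≤ l →
      Cor22.AdmitsCore P → Cor22.CondP2 P l → Cor22.CondP5 P l → Cor22.CondP6 P l →
      ∀ T : Cor22.ThetaVolumeDatumAt P l, ((St T).col (Pc T).n).KummerB ((St T).D (Pc T).n))
    (hPin : ∀ P : NFPoint, P ∈ UP → ∀ l : ℕ, l.Prime → 5 ≤ l →
      Cor22.AdmitsCore P → Cor22.CondP2 P l → Cor22.CondP5 P l → Cor22.CondP6 P l →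
      ∀ T : Cor22.ThetaVolumeDatumAt P l, PinnedRegions3 (St T) (Pc T) (ρ T) (qK T))
    (hS : ∀ P : NFPoint, P ∈ UP → ∀ l : ℕ, l.Prime → 5 ≤ l →
      Cor22.AdmitsCore P → Cor22.CondP2 P l → Cor22.CondP5 P l → Cor22.CondP6 P l →
      ∀ T : Cor22.ThetaVolumeDatumAt P l, PilotKummerIndRelated (St T) (Pc T) (ρ T) (qK T))
    (hΘ : ∀ P : NFPoint, P ∈ UP → ∀ l : ℕ, l.Prime → 5 ≤ l →
      Cor22.AdmitsCore P → Cor22.CondP2 P l → Cor22.CondP5 P l → Cor22.CondP6 P l →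
      ∀ T : Cor22.ThetaVolumeDatumAt P l, (Pc T).negLogTheta ≤ ((T.negLogTheta : ℝ) : WithTop ℝ))
    (hvol : ∀ P : NFPoint, P ∈ UP → ∀ l : ℕ, l.Prime → 5 ≤ l →
      Cor22.AdmitsCore P → Cor22.CondP2 P l → Cor22.CondP5 P l → Cor22.CondP6 P l →
        Cor22.HullVolumeAtDatum P l (((l : ℝ) + 1) / 4 *
          ((1 + 12 * (Cor22.dmod P : ℝ) / l) * (P.logDiff + Cor22.logCondAvoid P {2, l})
            + 2 * Real.log l + 52
            + 20 / 3 * Real.log (((2 ^ 12 * 3 ^ 3 * 5 * Cor22.dmod P : ℕ) : ℝ) * (l : ℝ))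
              * (Nat.primeCounting (2 ^ 12 * 3 ^ 3 * 5 * Cor22.dmod P * l) : ℝ)))) :
    Summit.ABC.ABC.Theses.IUTThetaPilot.ThetaPartII :=
  ThetaPartII_of_cor312_of_hullVolume
    (fun P hP l hl h5 hcore h2 hP5 h6 =>
      cor312AtDatum_of_pilotKummerIndRelated (fun T => TI T) (fun T => St T) (fun T => Pc T) (fun T => ρ T)
        (fun T => qK T) (hSet P hP l hl h5 hcore h2 hP5 h6) (hBridge P hP l hl h5 hcore h2 hP5 h6)
        (hKumB P hP l hl h5 hcore h2 hP5 h6) (hPin P hP l hl h5 hcore h2 hP5 h6) (hS P hP l hl h5 hcore h2 hP5 h6)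
        (hΘ P hP l hl h5 hcore h2 hP5 h6))
    hvol

/-- **`abc` FROM THE RESIDUAL S** (branch C re-based on the campaign-S chain): S at the Θ-data of every admissible
`(P, l)` of the `λ`-line (with setting data `St, Pc, ρ, qK`; [PIN] pins `hPin`, bridge hypotheses `hBridge`, provenance
`hSet`; [CONE] Thm. 3.11 (ii)(b) at column `n` `hKumB` and the computable half (ii′) `hvol`; [READ] `hΘ`) + [SUPPORT]
`GenEllTwo` ([GenEll] Thm. 2.1 at `Σ = {2}`, stmt-ABC-19679) ⟹ `_root_.ABC`, through abc-iut-S2's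
`ABC_of_cor312_of_hullVolume_of_genEllTwo` (route deciding theorem `closes` + `JInvWlog_proof`). No `AbcDictionary`,
`HeightFamily`, `Thm110Family` or `MochizukiIndeterminacies` binder; the `q`-side identification is proved. CONDITIONAL;
asserts nothing about abc; no side taken. [cite: Mochizuki2012, IUTchIV Cor. 2.2–2.3 pp.41–55]
[claim: Mochizuki2012, status: disputed] -/
theorem abc_of_pilotKummerIndRelated_of_genEllTwo
    (TI : ∀ {P : NFPoint} {l : ℕ}, Cor22.ThetaVolumeDatumAt P l → ThetaIndex)
    (St : ∀ {P : NFPoint} {l : ℕ} (T : Cor22.ThetaVolumeDatumAt P l), LatticeSituation (TI T))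
    (Pc : ∀ {P : NFPoint} {l : ℕ} (T : Cor22.ThetaVolumeDatumAt P l), Cor312.Setting (St T).toSituation)
    (ρ : ∀ {P : NFPoint} {l : ℕ} (T : Cor22.ThetaVolumeDatumAt P l),
      (∀ v : (TI T).V, v ∈ (TI T).Vbad → Set ((St T).L.StarPacket v)) →
        ∀ (j : (TI T).Label) (vQ : (TI T).VQ), Set ((St T).L.Packet j vQ))
    (qK : ∀ {P : NFPoint} {l : ℕ} (T : Cor22.ThetaVolumeDatumAt P l),
      ∀ v : (TI T).V, v ∈ (TI T).Vbad → Set ((St T).L.StarPacket v))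
    (hSet : ∀ P : NFPoint, P ∈ UP → ∀ l : ℕ, l.Prime → 5 ≤ l →
      Cor22.AdmitsCore P → Cor22.CondP2 P l → Cor22.CondP5 P l → Cor22.CondP6 P l →
      ∀ T : Cor22.ThetaVolumeDatumAt P l,
        letI := T.instFieldF; letI := T.instNumberFieldF; letI := T.instAlgebraF; letI := T.instFieldK
        letI := T.instNumberFieldK; letI := T.instAlgebraK; letI := T.instFieldFbar; letI := T.instAlgebraFbar
        letI := T.instAlgebraKFbar; letI := T.instIsElliptic
        Cor312Prov.IsSettingOf T.D (Pc T))
    (hBridge : ∀ P : NFPoint, P ∈ UP → ∀ l : ℕ, l.Prime → 5 ≤ l →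
      Cor22.AdmitsCore P → Cor22.CondP2 P l → Cor22.CondP5 P l → Cor22.CondP6 P l →
      ∀ T : Cor22.ThetaVolumeDatumAt P l, BridgeHyps (Pc T))
    (hKumB : ∀ P : NFPoint, P ∈ UP → ∀ l : ℕ, l.Prime → 5 ≤ l →
      Cor22.AdmitsCore P → Cor22.CondP2 P l → Cor22.CondP5 P l → Cor22.CondP6 P l →
      ∀ T : Cor22.ThetaVolumeDatumAt P l, ((St T).col (Pc T).n).KummerB ((St T).D (Pc T).n))
    (hPin : ∀ P : NFPoint, P ∈ UP → ∀ l : ℕ, l.Prime → 5 ≤ l →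
      Cor22.AdmitsCore P → Cor22.CondP2 P l → Cor22.CondP5 P l → Cor22.CondP6 P l →
      ∀ T : Cor22.ThetaVolumeDatumAt P l, PinnedRegions3 (St T) (Pc T) (ρ T) (qK T))
    (hS : ∀ P : NFPoint, P ∈ UP → ∀ l : ℕ, l.Prime → 5 ≤ l →
      Cor22.AdmitsCore P → Cor22.CondP2 P l → Cor22.CondP5 P l → Cor22.CondP6 P l →
      ∀ T : Cor22.ThetaVolumeDatumAt P l, PilotKummerIndRelated (St T) (Pc T) (ρ T) (qK T))
    (hΘ : ∀ P : NFPoint, P ∈ UP → ∀ l : ℕ, l.Prime → 5 ≤ l →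
      Cor22.AdmitsCore P → Cor22.CondP2 P l → Cor22.CondP5 P l → Cor22.CondP6 P l →
      ∀ T : Cor22.ThetaVolumeDatumAt P l, (Pc T).negLogTheta ≤ ((T.negLogTheta : ℝ) : WithTop ℝ))
    (hvol : ∀ P : NFPoint, P ∈ UP → ∀ l : ℕ, l.Prime → 5 ≤ l →
      Cor22.AdmitsCore P → Cor22.CondP2 P l → Cor22.CondP5 P l → Cor22.CondP6 P l →
        Cor22.HullVolumeAtDatum P l (((l : ℝ) + 1) / 4 *
          ((1 + 12 * (Cor22.dmod P : ℝ) / l) * (P.logDiff + Cor22.logCondAvoid P {2, l})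
            + 2 * Real.log l + 52
            + 20 / 3 * Real.log (((2 ^ 12 * 3 ^ 3 * 5 * Cor22.dmod P : ℕ) : ℝ) * (l : ℝ))
              * (Nat.primeCounting (2 ^ 12 * 3 ^ 3 * 5 * Cor22.dmod P * l) : ℝ))))
    (hG : Summit.ABC.ABC.Theses.IUTThetaPilot.GenEllTwo) : _root_.ABC :=
  ABC_of_cor312_of_hullVolume_of_genEllTwo
    (fun P hP l hl h5 hcore h2 hP5 h6 =>
      cor312AtDatum_of_pilotKummerIndRelated (fun T => TI T) (fun T => St T) (fun T => Pc T) (fun T => ρ T)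
        (fun T => qK T) (hSet P hP l hl h5 hcore h2 hP5 h6) (hBridge P hP l hl h5 hcore h2 hP5 h6)
        (hKumB P hP l hl h5 hcore h2 hP5 h6) (hPin P hP l hl h5 hcore h2 hP5 h6) (hS P hP l hl h5 hcore h2 hP5 h6)
        (hΘ P hP l hl h5 hcore h2 hP5 h6))
    hvol hG

/-! ## 4. The same apex keyed on the typed Theorem 3.11 as a whole (branch C's v0 binder names) — appended -/

/-- **`abc` from S, FullSituation-keyed twin** of `abc_of_pilotKummerIndRelated_of_genEllTwo` for branch C's binder names
(HOME/plan/conditional/HYPS.tsv v0: `F`, `Pc`, `ρ`, `qK`, `hS`, `hPin`, `hBridge`, `hThm311`): per datum a FULL typed situation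
`F T : Thm311.FullSituation (TI T)` of [IUTchIII] Thm. 3.11 with `hThm311 : (F T).Statement` (the root of the Cor. 3.12
cone, DAG kernel id `N_IUTchIII_Thm3_11`) in place of the strictly weaker `hKumB` (Thm. 3.11 as typed supplies (ii)(b) at
every column: abc-iut-c312-13's `GluedMonoids.kummerB_of_statement`). Binders: [S] `hS` · [PIN] `hPin`, `hBridge`, `hSet` ·
[CONE] `hThm311`, `hvol` · [READ] `hΘ` · [SUPPORT] `hG` = 8. CONDITIONAL; asserts nothing about abc; no side taken.
[cite: Mochizuki2012, IUTchIV Cor. 2.2–2.3 pp.41–55] [claim: Mochizuki2012, status: disputed] -/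
theorem abc_of_thm311_of_pilotKummerIndRelated_of_genEllTwo
    (TI : ∀ {P : NFPoint} {l : ℕ}, Cor22.ThetaVolumeDatumAt P l → ThetaIndex)
    (F : ∀ {P : NFPoint} {l : ℕ} (T : Cor22.ThetaVolumeDatumAt P l), FullSituation (TI T))
    (Pc : ∀ {P : NFPoint} {l : ℕ} (T : Cor22.ThetaVolumeDatumAt P l),
      Cor312.Setting (F T).toLatticeSituation.toSituation)
    (ρ : ∀ {P : NFPoint} {l : ℕ} (T : Cor22.ThetaVolumeDatumAt P l),
      (∀ v : (TI T).V, v ∈ (TI T).Vbad → Set ((F T).L.StarPacket v)) →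
        ∀ (j : (TI T).Label) (vQ : (TI T).VQ), Set ((F T).L.Packet j vQ))
    (qK : ∀ {P : NFPoint} {l : ℕ} (T : Cor22.ThetaVolumeDatumAt P l),
      ∀ v : (TI T).V, v ∈ (TI T).Vbad → Set ((F T).L.StarPacket v))
    (hSet : ∀ P : NFPoint, P ∈ UP → ∀ l : ℕ, l.Prime → 5 ≤ l →
      Cor22.AdmitsCore P → Cor22.CondP2 P l → Cor22.CondP5 P l → Cor22.CondP6 P l →
      ∀ T : Cor22.ThetaVolumeDatumAt P l,
        letI := T.instFieldF; letI := T.instNumberFieldF; letI := T.instAlgebraF; letI := T.instFieldK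
        letI := T.instNumberFieldK; letI := T.instAlgebraK; letI := T.instFieldFbar; letI := T.instAlgebraFbar
        letI := T.instAlgebraKFbar; letI := T.instIsElliptic
        Cor312Prov.IsSettingOf T.D (Pc T))
    (hBridge : ∀ P : NFPoint, P ∈ UP → ∀ l : ℕ, l.Prime → 5 ≤ l →
      Cor22.AdmitsCore P → Cor22.CondP2 P l → Cor22.CondP5 P l → Cor22.CondP6 P l →
      ∀ T : Cor22.ThetaVolumeDatumAt P l, BridgeHyps (Pc T))
    (hThm311 : ∀ P : NFPoint, P ∈ UP → ∀ l : ℕ, l.Prime → 5 ≤ l →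
      Cor22.AdmitsCore P → Cor22.CondP2 P l → Cor22.CondP5 P l → Cor22.CondP6 P l →
      ∀ T : Cor22.ThetaVolumeDatumAt P l, (F T).Statement)
    (hPin : ∀ P : NFPoint, P ∈ UP → ∀ l : ℕ, l.Prime → 5 ≤ l →
      Cor22.AdmitsCore P → Cor22.CondP2 P l → Cor22.CondP5 P l → Cor22.CondP6 P l →
      ∀ T : Cor22.ThetaVolumeDatumAt P l, PinnedRegions3 (F T).toLatticeSituation (Pc T) (ρ T) (qK T))
    (hS : ∀ P : NFPoint, P ∈ UP → ∀ l : ℕ, l.Prime → 5 ≤ l →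
      Cor22.AdmitsCore P → Cor22.CondP2 P l → Cor22.CondP5 P l → Cor22.CondP6 P l →
      ∀ T : Cor22.ThetaVolumeDatumAt P l, PilotKummerIndRelated (F T).toLatticeSituation (Pc T) (ρ T) (qK T))
    (hΘ : ∀ P : NFPoint, P ∈ UP → ∀ l : ℕ, l.Prime → 5 ≤ l →
      Cor22.AdmitsCore P → Cor22.CondP2 P l → Cor22.CondP5 P l → Cor22.CondP6 P l →
      ∀ T : Cor22.ThetaVolumeDatumAt P l, (Pc T).negLogTheta ≤ ((T.negLogTheta : ℝ) : WithTop ℝ))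
    (hvol : ∀ P : NFPoint, P ∈ UP → ∀ l : ℕ, l.Prime → 5 ≤ l →
      Cor22.AdmitsCore P → Cor22.CondP2 P l → Cor22.CondP5 P l → Cor22.CondP6 P l →
        Cor22.HullVolumeAtDatum P l (((l : ℝ) + 1) / 4 *
          ((1 + 12 * (Cor22.dmod P : ℝ) / l) * (P.logDiff + Cor22.logCondAvoid P {2, l})
            + 2 * Real.log l + 52
            + 20 / 3 * Real.log (((2 ^ 12 * 3 ^ 3 * 5 * Cor22.dmod P : ℕ) : ℝ) * (l : ℝ))
              * (Nat.primeCounting (2 ^ 12 * 3 ^ 3 * 5 * Cor22.dmod P * l) : ℝ))))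
    (hG : Summit.ABC.ABC.Theses.IUTThetaPilot.GenEllTwo) : _root_.ABC :=
  abc_of_pilotKummerIndRelated_of_genEllTwo (fun T => TI T) (fun T => (F T).toLatticeSituation) (fun T => Pc T)
    (fun T => ρ T) (fun T => qK T) hSet hBridge
    (fun P hP l hl h5 hcore h2 hP5 h6 T =>
      GluedMonoids.kummerB_of_statement (F T) (hThm311 P hP l hl h5 hcore h2 hP5 h6 T) (Pc T).n)
    hPin hS hΘ hvol hG

/-! ## 5. The `d = 1` cut: Vojta for the rational points of the `λ`-line, from S alone (log-volume side discharged) — appended -/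

/-- **Vojta's height inequality in degree `1` on every compactly bounded `K_V ∋ 2` of `ℙ¹ ∖ {0, 1, ∞}` FROM THE RESIDUAL
S** at the Θ-data of the rational points of the `λ`-line (with their setting data, pins, bridge hypotheses, Thm. 3.11
(ii)(b) at column `n`, and the Θ-side reading `hΘ`) — NO log-volume, fact or dictionary binder: abc-iut-S2's
`ThetaPartIIDisplay.vojtaIneq_two_degOne_of_cor312` (the computable half is a theorem at `d_mod = 1`; child (i) is a
theorem) composed with `cor312AtDatum_of_pilotKummerIndRelated`. CONDITIONAL on S; asserts nothing about any curve.
[cite: Mochizuki2012, IUTchIV Cor. 2.2–2.3 pp.41–55] [claim: Mochizuki2012, status: disputed] -/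
theorem vojta_degOne_of_pilotKummerIndRelated
    (TI : ∀ {P : NFPoint} {l : ℕ}, Cor22.ThetaVolumeDatumAt P l → ThetaIndex)
    (St : ∀ {P : NFPoint} {l : ℕ} (T : Cor22.ThetaVolumeDatumAt P l), LatticeSituation (TI T))
    (Pc : ∀ {P : NFPoint} {l : ℕ} (T : Cor22.ThetaVolumeDatumAt P l), Cor312.Setting (St T).toSituation)
    (ρ : ∀ {P : NFPoint} {l : ℕ} (T : Cor22.ThetaVolumeDatumAt P l),
      (∀ v : (TI T).V, v ∈ (TI T).Vbad → Set ((St T).L.StarPacket v)) →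
        ∀ (j : (TI T).Label) (vQ : (TI T).VQ), Set ((St T).L.Packet j vQ))
    (qK : ∀ {P : NFPoint} {l : ℕ} (T : Cor22.ThetaVolumeDatumAt P l),
      ∀ v : (TI T).V, v ∈ (TI T).Vbad → Set ((St T).L.StarPacket v))
    (hSet : ∀ P : NFPoint, P ∈ UP → P.degree ≤ 1 → ∀ l : ℕ, l.Prime → 5 ≤ l →
      Cor22.AdmitsCore P → Cor22.CondP2 P l → Cor22.CondP5 P l → Cor22.CondP6 P l →
      ∀ T : Cor22.ThetaVolumeDatumAt P l,
        letI := T.instFieldF; letI := T.instNumberFieldF; letI := T.instAlgebraF; letI := T.instFieldK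
        letI := T.instNumberFieldK; letI := T.instAlgebraK; letI := T.instFieldFbar; letI := T.instAlgebraFbar
        letI := T.instAlgebraKFbar; letI := T.instIsElliptic
        Cor312Prov.IsSettingOf T.D (Pc T))
    (hBridge : ∀ P : NFPoint, P ∈ UP → P.degree ≤ 1 → ∀ l : ℕ, l.Prime → 5 ≤ l →
      Cor22.AdmitsCore P → Cor22.CondP2 P l → Cor22.CondP5 P l → Cor22.CondP6 P l →
      ∀ T : Cor22.ThetaVolumeDatumAt P l, BridgeHyps (Pc T))
    (hKumB : ∀ P : NFPoint, P ∈ UP → P.degree ≤ 1 → ∀ l : ℕ, l.Prime → 5 ≤ l →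
      Cor22.AdmitsCore P → Cor22.CondP2 P l → Cor22.CondP5 P l → Cor22.CondP6 P l →
      ∀ T : Cor22.ThetaVolumeDatumAt P l, ((St T).col (Pc T).n).KummerB ((St T).D (Pc T).n))
    (hPin : ∀ P : NFPoint, P ∈ UP → P.degree ≤ 1 → ∀ l : ℕ, l.Prime → 5 ≤ l →
      Cor22.AdmitsCore P → Cor22.CondP2 P l → Cor22.CondP5 P l → Cor22.CondP6 P l →
      ∀ T : Cor22.ThetaVolumeDatumAt P l, PinnedRegions3 (St T) (Pc T) (ρ T) (qK T))
    (hS : ∀ P : NFPoint, P ∈ UP → P.degree ≤ 1 → ∀ l : ℕ, l.Prime → 5 ≤ l →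
      Cor22.AdmitsCore P → Cor22.CondP2 P l → Cor22.CondP5 P l → Cor22.CondP6 P l →
      ∀ T : Cor22.ThetaVolumeDatumAt P l, PilotKummerIndRelated (St T) (Pc T) (ρ T) (qK T))
    (hΘ : ∀ P : NFPoint, P ∈ UP → P.degree ≤ 1 → ∀ l : ℕ, l.Prime → 5 ≤ l →
      Cor22.AdmitsCore P → Cor22.CondP2 P l → Cor22.CondP5 P l → Cor22.CondP6 P l →
      ∀ T : Cor22.ThetaVolumeDatumAt P l, (Pc T).negLogTheta ≤ ((T.negLogTheta : ℝ) : WithTop ℝ))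
    {ε : ℝ} (hε : 0 < ε) (D : CBData) (hD : D.SupportContains {2}) : VojtaIneq D.toSet 1 ε :=
  ThetaPartIIDisplay.vojtaIneq_two_degOne_of_cor312
    (fun P hP hdeg l hl h5 hcore h2 hP5 h6 =>
      cor312AtDatum_of_pilotKummerIndRelated (fun T => TI T) (fun T => St T) (fun T => Pc T) (fun T => ρ T)
        (fun T => qK T) (hSet P hP hdeg l hl h5 hcore h2 hP5 h6) (hBridge P hP hdeg l hl h5 hcore h2 hP5 h6)
        (hKumB P hP hdeg l hl h5 hcore h2 hP5 h6) (hPin P hP hdeg l hl h5 hcore h2 hP5 h6)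
        (hS P hP hdeg l hl h5 hcore h2 hP5 h6) (hΘ P hP hdeg l hl h5 hcore h2 hP5 h6))
    hε D hD

end Summit.ABC.ABC.Theorems.ThetaPartII

end
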